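import Mathlib.Analysis.Normed.Module.HahnBanach
import Literature.Geometry.Lorentzian.CausalityPushUp

/-!
# Route SwallowTheDatum · item `SubdataDevelopmentsEmbed` (stmt-FinalStateConjecture-10053) —
# towards the domain of dependence of the sub-datum (`hcauchy`), I: the uniform cone bound in a
# chart and the Lipschitz estimate for timelike curves

Two elementary tools for the causality theory of a SPACELIKE Cauchy hypersurface (the hypothesis
`hcauchy` of `subdataDevelopmentsEmbed_of_hloc_hcauchy_hncb`, `…Skeleton2.lean`):

* `cone_curve_estimate` — **curves whose velocity lies in a closed convex cone are Lipschitz in the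
  cone's height**: if `σ : ℝ → F` has `c‖σ'‖ ≤ ℓ(σ')` on an interval (`ℓ` a covector, `c > 0`),
  then `ℓ ∘ σ` is monotone and `c‖σ t₂ - σ t₁‖ ≤ ℓ(σ t₂) - ℓ(σ t₁)` (mean value inequality through a
  norming functional, Hahn–Banach `exists_dual_vector`);
* `exists_cone_bound` — **the uniform cone bound**: on a finite-dimensional manifold without
  boundary with a `Cⁿ` (`n ≥ 1`) time-oriented Lorentzian metric, for every point `p` and every
  future timelike vector `W` at `p` there are `c, r > 0` such that, in the extended chart `φ` at
  `p`, every future timelike vector `u` at a point `y` with `‖φ y - φ p‖ < r` has coordinate image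
  `û` with `c‖û‖ ≤ ℓ(û)`, `ℓ = -Ĝ_{φ p}(Ŵ, ·)` (O'Neill 1983, Ch. 5, Lemma 5.26 ff. pointwise;
  uniformity from `PushUp.exists_cone_const` — compactness of the unit sphere — and the continuity
  of the coordinate metric, the future direction being tested against the constant coordinate
  field `Ŵ`, future timelike near `φ p`).

No definition, no named fact.
-/

noncomputable section

open Function Set Filter Topology TopologicalSpace Bundle Manifold
open scoped Manifold ContDiff Topology

namespace Summit.FinalStateConjecture.FinalStateConjecture.Theorems

namespace SubdataDevelopmentsEmbed

open Literature.Geometry.Lorentzian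

/-! ### Curves with velocity in a cone -/

section Cone

variable {F : Type*} [NormedAddCommGroup F] [NormedSpace ℝ F]

/-- **Mean value inequality for a curve whose velocity lies in the cone `{c‖v‖ ≤ ℓ v}`.** If
`σ : ℝ → F` is differentiable at every point of an interval `J` with `c‖σ' t‖ ≤ ℓ(σ' t)` (`ℓ` a
continuous covector, `c > 0`), then for `t₁ ≤ t₂` in `J`: `ℓ(σ t₁) ≤ ℓ(σ t₂)` and
`c‖σ t₂ - σ t₁‖ ≤ ℓ(σ t₂) - ℓ(σ t₁)`. Proof: for a norming functional `φ` of `σ t₂ - σ t₁`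
(`‖φ‖ = 1`, Hahn–Banach) the real function `ℓ ∘ σ - c φ ∘ σ` has nonnegative derivative, hence is
monotone (`monotoneOn_of_deriv_nonneg`). -/
theorem cone_curve_estimate (ℓ : F →L[ℝ] ℝ) {c : ℝ} (hc : 0 < c) {σ σ' : ℝ → F} {J : Set ℝ}
    (hJ : J.OrdConnected) (hσ : ∀ t ∈ J, HasDerivAt σ (σ' t) t)
    (hcone : ∀ t ∈ J, c * ‖σ' t‖ ≤ ℓ (σ' t)) {t₁ t₂ : ℝ} (h₁ : t₁ ∈ J) (h₂ : t₂ ∈ J)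
    (h12 : t₁ ≤ t₂) :
    ℓ (σ t₁) ≤ ℓ (σ t₂) ∧ c * ‖σ t₂ - σ t₁‖ ≤ ℓ (σ t₂) - ℓ (σ t₁) := by
  -- for every functional `φ` of norm `≤ 1`, `ℓ ∘ σ - c φ ∘ σ` is monotone on `J`
  have key : ∀ φ : F →L[ℝ] ℝ, ‖φ‖ ≤ 1 →
      ℓ (σ t₁) - c * φ (σ t₁) ≤ ℓ (σ t₂) - c * φ (σ t₂) := by
    intro φ hφ
    set f : ℝ → ℝ := fun t ↦ ℓ (σ t) - c * φ (σ t) with hf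
    have hderiv : ∀ t ∈ J, HasDerivAt f (ℓ (σ' t) - c * φ (σ' t)) t := fun t ht ↦
      ((ℓ.hasFDerivAt.comp_hasDerivAt t (hσ t ht)).sub
        ((φ.hasFDerivAt.comp_hasDerivAt t (hσ t ht)).const_mul c))
    have hmono : MonotoneOn f J := by
      refine monotoneOn_of_deriv_nonneg hJ.convex (fun t ht ↦ (hderiv t ht).continuousAt.continuousWithinAt)
        (fun t ht ↦ (hderiv t (interior_subset ht)).differentiableAt.differentiableWithinAt)
        fun t ht ↦ ?_
      rw [(hderiv t (interior_subset ht)).deriv]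
      have h1 : φ (σ' t) ≤ ‖σ' t‖ := by
        have := φ.le_opNorm (σ' t)
        have h2 : ‖φ‖ * ‖σ' t‖ ≤ 1 * ‖σ' t‖ := mul_le_mul_of_nonneg_right hφ (norm_nonneg _)
        rw [one_mul] at h2
        exact (le_abs_self _).trans ((Real.norm_eq_abs _).symm.le.trans (this.trans h2))
      have h3 := hcone t (interior_subset ht)
      nlinarith
    exact hmono h₁ h₂ h12
  constructor
  · have h := key 0 (by simp)
    simpa using h
  · obtain ⟨φ, hφ1, hφ⟩ := exists_dual_vector'' ℝ (σ t₂ - σ t₁)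
    have h := key φ hφ1
    rw [map_sub] at hφ
    have hn : (‖σ t₂ - σ t₁‖ : ℝ) = φ (σ t₂) - φ (σ t₁) := by
      have := hφ
      exact_mod_cast this.symm
    rw [hn]
    linarith

end Cone

/-! ### The uniform cone bound in a chart -/

section ConeBound

variable {E : Type*} [NormedAddCommGroup E] [NormedSpace ℝ E] {H : Type*} [TopologicalSpace H]
  {I : ModelWithCorners ℝ E H} {n : ℕ∞ω} {M : Type*} [TopologicalSpace M] [ChartedSpace H M]
  [IsManifold I ∞ M] {g : LorentzianMetric I n M} {τ : TimeOrientation g}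

/-- **The uniform cone bound.** Let `p ∈ M` and `W` a future timelike vector at `p`; write `φ`
for the extended chart at `p`, `Ĝ` for the coordinate metric, `Ŵ` for the coordinate image of
`W` and `ℓ = -Ĝ_{φ p}(Ŵ, ·)`. There are `c, r > 0` with `B(φ p, r) ⊆ φ.target` such that for
every `y` in the chart domain with `‖φ y - φ p‖ < r` and every future timelike `u ∈ T_y M`, the
coordinate image `û` satisfies `c‖û‖ ≤ ℓ(û)`. Pointwise this is O'Neill 1983, Ch. 5, Lemma 5.26
ff. (a timelike vector is never orthogonal to a causal one, and two future timelike vectors have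
negative scalar product); the uniform constant comes from `PushUp.exists_cone_const` and the
continuity of `Ĝ`, the future direction at `y` being tested against the coordinate-constant
field `Ŵ`, which is future timelike near `φ p`. -/
theorem exists_cone_bound [BoundarylessManifold I M] [FiniteDimensional ℝ E] (hn : 1 ≤ n) (p : M)
    {W : TangentSpace I p} (hW : g.IsTimelike W) (hWf : τ.IsFutureDirected W) :
    ∃ c > 0, ∃ r > 0, Metric.ball (extChartAt I p p) r ⊆ (extChartAt I p).target ∧
      ∀ y ∈ (chartAt H p).source, ‖extChartAt I p y - extChartAt I p p‖ < r →
        ∀ u : TangentSpace I y, g.IsTimelike u → τ.IsFutureDirected u →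
          c * ‖(trivializationAt E (TangentSpace I) p).continuousLinearMapAt ℝ y u‖ ≤
            -(g.coordMetric p (extChartAt I p p)
              ((trivializationAt E (TangentSpace I) p).continuousLinearMapAt ℝ p W)
              ((trivializationAt E (TangentSpace I) p).continuousLinearMapAt ℝ y u)) := by
  -- the chart at `p`
  set x₀ : E := extChartAt I p p with hx₀def
  have hx₀t : x₀ ∈ (extChartAt I p).target :=
    (extChartAt I p).map_source (mem_extChartAt_source p)
  have hx₀p : (extChartAt I p).symm x₀ = p := (extChartAt I p).left_inv (mem_extChartAt_source p)
  have htarget : (extChartAt I p).target ∈ 𝓝 x₀ := by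
    have hint : x₀ ∈ interior (extChartAt I p).target :=
      ModelWithCorners.isInteriorPoint_iff.mp (BoundarylessManifold.isInteriorPoint (I := I))
    exact mem_interior_iff_mem_nhds.mp hint
  set eT := trivializationAt E (TangentSpace I) p with heT
  set W₀ : E := eT.continuousLinearMapAt ℝ p W with hW₀def
  have hGcd : ContDiffOn ℝ 1 (g.coordMetric p) (extChartAt I p).target :=
    g.contDiffOn_coordMetric hn p
  have hGc : ContinuousAt (g.coordMetric p) x₀ := (hGcd.continuousOn x₀ hx₀t).continuousAt htarget
  have hGTc : ContinuousAt (fun x ↦ g.coordMetric p x (τ.coordTime p x)) x₀ :=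
    ((hGcd.continuousOn.clm_apply (τ.continuousOn_coordTime hn p)) x₀ hx₀t).continuousAt htarget
  -- `W₀` is the coordinate image of `W`
  have hpb : p ∈ eT.baseSet := by simp [heT]
  have hyb : (extChartAt I p).symm x₀ ∈ eT.baseSet := by rw [hx₀p]; exact hpb
  have hsymmW₀ : eT.symmL ℝ ((extChartAt I p).symm x₀) W₀ = W := by
    have h : eT.symmL ℝ p W₀ = W := by
      rw [hW₀def]
      exact eT.symmL_continuousLinearMapAt hpb W
    have hgen : ∀ q, q = p → eT.symmL ℝ q W₀ = (W : E) := by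
      rintro q rfl; exact h
    exact hgen _ hx₀p
  have hW₀W₀ : g.coordMetric p x₀ W₀ W₀ < 0 := by
    rw [g.coordMetric_apply hx₀t W₀ W₀, hsymmW₀, hx₀p]
    exact hW
  have hTW₀ : g.coordMetric p x₀ (τ.coordTime p x₀) W₀ < 0 := by
    rw [coordMetric_coordTime_apply hx₀t, hsymmW₀, hx₀p]
    exact hWf.2
  -- a timelike vector is never orthogonal to a causal one
  have hpos : ∀ v : E, v ≠ 0 → g.coordMetric p x₀ v v ≤ 0 → g.coordMetric p x₀ W₀ v ≤ 0 →
      g.coordMetric p x₀ W₀ v < 0 := by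
    intro v hv0 hvv hTv
    refine lt_of_le_of_ne hTv fun h0 ↦ ?_
    have hcv : g.IsCausal (eT.symmL ℝ ((extChartAt I p).symm x₀) v) :=
      (isCausal_symmL_iff hx₀t v).mpr ⟨hvv, hv0⟩
    have hWt : g.IsTimelike (eT.symmL ℝ ((extChartAt I p).symm x₀) W₀) := by
      rw [LorentzianMetric.isTimelike_iff, ← g.coordMetric_apply hx₀t]
      exact hW₀W₀
    refine g.val_ne_zero_of_isTimelike_of_isCausal hWt hcv ?_
    rw [← g.coordMetric_apply hx₀t]
    exact h0
  obtain ⟨c, hc, m, hm, hcone⟩ := PushUp.exists_cone_const (g.coordMetric p x₀) W₀ hpos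
  -- radius `δ₁`: target, `Ŵ` future timelike
  obtain ⟨δ₁, hδ₁, hδ₁'⟩ : ∃ δ > 0, ∀ z : E, ‖z - x₀‖ < δ → z ∈ (extChartAt I p).target ∧
      g.coordMetric p z W₀ W₀ < 0 ∧ g.coordMetric p z (τ.coordTime p z) W₀ < 0 := by
    have h1 : ∀ᶠ z in 𝓝 x₀, z ∈ (extChartAt I p).target := htarget
    have h4 : ∀ᶠ z in 𝓝 x₀, g.coordMetric p z W₀ W₀ < 0 := by
      have hcts : ContinuousAt (fun z ↦ g.coordMetric p z W₀ W₀) x₀ :=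
        (hGc.clm_apply continuousAt_const).clm_apply continuousAt_const
      exact hcts.preimage_mem_nhds (Iio_mem_nhds hW₀W₀)
    have h5 : ∀ᶠ z in 𝓝 x₀, g.coordMetric p z (τ.coordTime p z) W₀ < 0 := by
      have hcts : ContinuousAt (fun z ↦ g.coordMetric p z (τ.coordTime p z) W₀) x₀ :=
        hGTc.clm_apply continuousAt_const
      exact hcts.preimage_mem_nhds (Iio_mem_nhds hTW₀)
    obtain ⟨δ, hδ, h⟩ := Metric.eventually_nhds_iff.mp (h1.and (h4.and h5))
    exact ⟨δ, hδ, fun z hz ↦ h (by rwa [dist_eq_norm])⟩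
  -- radius `δ₂`: closeness of `Ĝ` to its value at `x₀` (and hence of the covector `Ĝ(Ŵ, ·)`)
  have hm₁ : 0 < min m (m / (‖W₀‖ + 1)) := lt_min hm (by positivity)
  obtain ⟨δ₂, hδ₂, hδ₂'⟩ : ∃ δ > 0, ∀ z : E, ‖z - x₀‖ < δ →
      ‖g.coordMetric p z - g.coordMetric p x₀‖ < min m (m / (‖W₀‖ + 1)) :=
    (NormedAddCommGroup.tendsto_nhds_nhds (f := g.coordMetric p) (x := x₀)
      (y := g.coordMetric p x₀)).1 hGc.tendsto _ hm₁
  set r : ℝ := min δ₁ δ₂ with hrdef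
  have hr0 : 0 < r := lt_min hδ₁ hδ₂
  refine ⟨c, hc, r, hr0, fun z hz ↦ (hδ₁' z (lt_of_lt_of_le (by
      rw [← dist_eq_norm]; exact Metric.mem_ball.mp hz) (min_le_left _ _))).1, ?_⟩
  intro y hy hyr u hut huf
  set z : E := extChartAt I p y with hzdef
  have hzδ₁ : ‖z - x₀‖ < δ₁ := lt_of_lt_of_le hyr (min_le_left _ _)
  have hzδ₂ : ‖z - x₀‖ < δ₂ := lt_of_lt_of_le hyr (min_le_right _ _)
  obtain ⟨hzt, hzW, hzTW⟩ := hδ₁' z hzδ₁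
  have hy' : y ∈ (extChartAt I p).source := by rwa [extChartAt_source]
  have hyz : (extChartAt I p).symm z = y := (extChartAt I p).left_inv hy'
  have hyb' : y ∈ eT.baseSet := by simpa [heT] using hy
  set v : E := eT.continuousLinearMapAt ℝ y u with hvdef
  have hsymmv : eT.symmL ℝ ((extChartAt I p).symm z) v = u := by
    have h : eT.symmL ℝ y v = u := by rw [hvdef]; exact eT.symmL_continuousLinearMapAt hyb' u
    have hgen : ∀ q, q = y → eT.symmL ℝ q v = (u : E) := by
      rintro q rfl; exact h
    exact hgen _ hyz
  -- the coordinate conditions at `z`: `u` timelike, and future w.r.t. the reference vector `Ŵ`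
  have hvv : g.coordMetric p z v v ≤ 0 := by
    rw [g.coordMetric_apply hzt, hsymmv, hyz]
    exact hut.le
  have hWv : g.coordMetric p z W₀ v < 0 := by
    -- `Ŵ` read at `y` is future timelike there, `u` is future timelike: negative scalar product
    have hWy : g.val ((extChartAt I p).symm z) (eT.symmL ℝ ((extChartAt I p).symm z) W₀)
        (eT.symmL ℝ ((extChartAt I p).symm z) W₀) < 0 := by
      rw [← g.coordMetric_apply hzt]; exact hzW
    have hTWy : g.val ((extChartAt I p).symm z) (τ.vectorField _)
        (eT.symmL ℝ ((extChartAt I p).symm z) W₀) < 0 := by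
      rw [← coordMetric_coordTime_apply hzt]; exact hzTW
    rw [g.coordMetric_apply hzt, hsymmv]
    have hgen : ∀ q, q = y →
        g.val q (eT.symmL ℝ q W₀) (eT.symmL ℝ q W₀) < 0 →
        g.val q (τ.vectorField q) (eT.symmL ℝ q W₀) < 0 →
        g.val q (eT.symmL ℝ q W₀) u < 0 := by
      rintro q rfl h1 h2
      exact LorentzianMetric.val_lt_zero_of_isFutureDirected τ h1 h2 hut huf.2
    exact hgen _ hyz hWy hTWy
  have hclose : ‖g.coordMetric p z - g.coordMetric p x₀‖ < m :=
    lt_of_lt_of_le (hδ₂' z hzδ₂) (min_le_left _ _)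
  have hclose' : ‖g.coordMetric p z W₀ - g.coordMetric p x₀ W₀‖ < m := by
    have h1 : g.coordMetric p z W₀ - g.coordMetric p x₀ W₀ =
        (g.coordMetric p z - g.coordMetric p x₀) W₀ := rfl
    rw [h1]
    have h2 := (g.coordMetric p z - g.coordMetric p x₀).le_opNorm W₀
    have h3 : ‖g.coordMetric p z - g.coordMetric p x₀‖ < m / (‖W₀‖ + 1) :=
      lt_of_lt_of_le (hδ₂' z hzδ₂) (min_le_right _ _)
    have h4 : ‖g.coordMetric p z - g.coordMetric p x₀‖ * ‖W₀‖ ≤ m / (‖W₀‖ + 1) * ‖W₀‖ :=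
      mul_le_mul_of_nonneg_right h3.le (norm_nonneg _)
    have h5 : m / (‖W₀‖ + 1) * ‖W₀‖ < m := by
      rw [div_mul_eq_mul_div, div_lt_iff₀ (by positivity)]
      nlinarith [norm_nonneg W₀]
    linarith
  exact hcone (g.coordMetric p z) (g.coordMetric p z W₀) hclose hclose' v hvv hWv

end ConeBound

end SubdataDevelopmentsEmbed

end Summit.FinalStateConjecture.FinalStateConjecture.Theorems

end
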